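import Literature.NumberTheory.Transcendental.KZMellinFibres
import Literature.NumberTheory.Transcendental.KZDominatedFamilyRelations
import HarnessLib

/-!
# Peeling the unit ball, companion: the fold `[(−1,1), (1−x²)^γ] ∼ [(0,1), t^{−1/2}(1−t)^γ]`

Companion of `KZBallPeeling.lean` (independent of it). Generic, fully proved move chains of the
Kontsevich–Zagier calculus (Kontsevich–Zagier 2001, §1.2) for representations PINNED by domain and
integrand, in dimension one:

* `KZ.BallPeeling.of_sub_of_mem_relations_of_neg` — `x ↦ −x` on `ℝ¹` is ONE change of variables;
* `KZ.BallPeeling.symmetricBeta_equivalent` — for every real `γ`,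
  `[(−1,1), (1 − x²)^γ] ∼ [(0,1), t^{1/2 − 1} (1 − t)^γ]`: split `(−1,1)` at the null point `0`
  (rule 1a), fold `(−1,0)` onto `(0,1)` by `x ↦ −x` (rule 2), merge the two equal copies
  (rule 1b: `2f = f + f`), substitute `t = x²` (rule 2, `|dt/dx| = 2x`):
  `2 (1 − x²)^γ = (x²)^{−1/2} (1 − x²)^γ · 2x`. Value identity:
  `∫_{−1}^{1} (1 − x²)^γ dx = B(1/2, γ + 1)`;
* `…_rat`, `…_nat`, `…_nat_add_half` — the same with the Beta side spelled
  `t^{a−1}(1−t)^{b−1}`, `a = 1/2`, `b ∈ ℚ` (resp. `b = e + 1`, `b = e + 3/2`, `e ∈ ℕ`);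
* `KZ.BallPeeling.exists_symIntervalRep_nat`, `…_nat_add_half` — the representations
  `[(−1,1), (1 − x²)^e]`, `[(−1,1), (1 − x²)^{e + 1/2}]` exist.

Everything is proved; no `def`, no named fact.
-/

noncomputable section

open MeasureTheory Set
open Literature.ModelTheory.ExponentialFields (IsSemialgebraic)
open MvPolynomial (aeval X C)

namespace Literature.NumberTheory.Transcendental

namespace KZ

namespace BallPeeling

/-! ## Intervals in `ℝ¹` -/

/-- Open intervals with rational endpoints (first-coordinate spelling) are `ℚ`-semialgebraic in
`ℝ¹`. [folklore] -/
theorem isSemialgebraic_Ioo₁ (a b : ℚ) :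
    IsSemialgebraic ℚ {x : Fin 1 → ℝ | x 0 ∈ Set.Ioo (a:ℝ) b} := by
  have h1 := Literature.ModelTheory.ExponentialFields.isSemialgebraic_setOf_eval_lt (k := ℚ)
    (R := ℝ) (C a : MvPolynomial (Fin 1) ℚ) (X 0)
  have h2 := Literature.ModelTheory.ExponentialFields.isSemialgebraic_setOf_eval_lt (k := ℚ)
    (R := ℝ) (X 0 : MvPolynomial (Fin 1) ℚ) (C b)
  have h := h1.inter h2
  have hset : {x : Fin 1 → ℝ | x 0 ∈ Set.Ioo (a:ℝ) b} =
      {x | aeval x (C a : MvPolynomial (Fin 1) ℚ) < aeval x (X 0 : MvPolynomial (Fin 1) ℚ)} ∩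
        {x | aeval x (X 0 : MvPolynomial (Fin 1) ℚ) < aeval x (C b : MvPolynomial (Fin 1) ℚ)} := by
    ext x
    simp
  rw [hset]
  exact h

/-- `(−1,1) ⊆ ℝ¹` is `ℚ`-semialgebraic. [folklore] -/
theorem isSemialgebraic_symIoo : IsSemialgebraic ℚ {x : Fin 1 → ℝ | x 0 ∈ Set.Ioo (-1:ℝ) 1} := by
  simpa using isSemialgebraic_Ioo₁ (-1) 1

/-- `(−1,0) ⊆ ℝ¹` is `ℚ`-semialgebraic. [folklore] -/
theorem isSemialgebraic_negIoo : IsSemialgebraic ℚ {x : Fin 1 → ℝ | x 0 ∈ Set.Ioo (-1:ℝ) 0} := by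
  simpa using isSemialgebraic_Ioo₁ (-1) 0

/-- `(0,1) ⊆ ℝ¹` is `ℚ`-semialgebraic. [folklore] -/
theorem isSemialgebraic_posIoo : IsSemialgebraic ℚ {x : Fin 1 → ℝ | x 0 ∈ Set.Ioo (0:ℝ) 1} := by
  simpa using isSemialgebraic_Ioo₁ 0 1

/-- A coordinate hyperplane of `ℝᵏ` is Lebesgue-null. [folklore] -/
theorem volume_setOf_apply_eq_const (k : ℕ) (i : Fin k) (c : ℝ) :
    volume {w : Fin k → ℝ | w i = c} = 0 := by
  rw [volume_pi]
  exact Measure.pi_hyperplane _ _ _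

/-! ## Existence of the symmetric interval representations -/

/-- A function on `(−1,1) ⊆ ℝ¹` which is `ℚ`-semialgebraic there and continuous on `ℝ¹` is the
integrand of a representation on `(−1,1)` (integrable: continuous on the compact `[−1,1]`).
[folklore] -/
theorem exists_symIntervalRep_of (f : (Fin 1 → ℝ) → ℝ)
    (hsa : IsSemialgebraicFunOn ℚ {x : Fin 1 → ℝ | x 0 ∈ Set.Ioo (-1:ℝ) 1} f) (hf : Continuous f) :
    ∃ r : IntegralRep 1, r.domain = {x | x 0 ∈ Set.Ioo (-1:ℝ) 1} ∧ r.integrand = f := by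
  have hK : IsCompact (Set.pi univ fun _ : Fin 1 => Set.Icc (-1:ℝ) 1) :=
    isCompact_univ_pi fun _ => isCompact_Icc
  have hint : IntegrableOn f {x : Fin 1 → ℝ | x 0 ∈ Set.Ioo (-1:ℝ) 1} := by
    refine (hf.continuousOn.integrableOn_compact hK).mono_set fun x hx => ?_
    have hx' : -1 < x 0 ∧ x 0 < 1 := hx
    simp only [mem_univ_pi, Fin.forall_fin_one, mem_Icc]
    exact ⟨hx'.1.le, hx'.2.le⟩
  exact ⟨⟨_, _, isSemialgebraic_symIoo, hsa, hint⟩, rfl, rfl⟩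

/-- **`[(−1,1), (1 − x²)^e]` exists** (`e ∈ ℕ`; polynomial integrand). [folklore] -/
theorem exists_symIntervalRep_nat (e : ℕ) :
    ∃ r : IntegralRep 1, r.domain = {x | x 0 ∈ Set.Ioo (-1:ℝ) 1} ∧
      r.integrand = fun x => (1 - (x 0) ^ 2) ^ e := by
  refine exists_symIntervalRep_of _ ?_ (by fun_prop)
  exact (isSemialgebraicFunOn_aeval isSemialgebraic_symIoo ((1 - X 0 ^ 2) ^ e)).congr
    fun x _ => by simp

/-- **`[(−1,1), (1 − x²)^{e + 1/2}]` exists** (`e ∈ ℕ`; an Euler–Mellin integrand with rational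
exponent, `ℚ`-semialgebraic by `KZ.isSemialgebraicFunOn_mellinIntegrand`). [folklore] -/
theorem exists_symIntervalRep_nat_add_half (e : ℕ) :
    ∃ r : IntegralRep 1, r.domain = {x | x 0 ∈ Set.Ioo (-1:ℝ) 1} ∧
      r.integrand = fun x => (1 - (x 0) ^ 2) ^ ((e : ℝ) + 1 / 2) := by
  refine exists_symIntervalRep_of _ ?_ ?_
  · refine (isSemialgebraicFunOn_mellinIntegrand isSemialgebraic_symIoo
      ![(1 - X 0 ^ 2 : MvPolynomial (Fin 1) ℚ)] ![(e : ℚ) + 1 / 2] 1 (fun x hx k => ?_)).congr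
      fun x _ => ?_
    · have hx' : -1 < x 0 ∧ x 0 < 1 := hx
      fin_cases k
      simp only [Fin.zero_eta, Matrix.cons_val_zero, map_sub, map_one, map_pow,
        MvPolynomial.aeval_X, sub_pos, sq_lt_one_iff_abs_lt_one, abs_lt]
      exact hx'
    · simp [mellinIntegrand_apply]
  · exact (by fun_prop : Continuous fun x : Fin 1 → ℝ => 1 - (x 0) ^ 2).rpow_const
      fun _ => Or.inr (by positivity)

/-! ## The reflection `x ↦ −x` -/

/-- **`x ↦ −x` on `ℝ¹` is a change-of-variables move**: if `r'.domain = −(r.domain)` and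
`f(x) = f'(−x)` on `r.domain` then `[r] − [r'] ∈ relations` (`Φ = −id`, `|det| = 1`).
[cite: KontsevichZagier2001, §1.2 rule (2)] -/
theorem of_sub_of_mem_relations_of_neg {r r' : IntegralRep 1}
    (hd : r'.domain = (fun x => -x) '' r.domain)
    (hi : ∀ x ∈ r.domain, r.integrand x = r'.integrand (-x)) : of r - of r' ∈ relations := by
  set L : (Fin 1 → ℝ) →L[ℝ] (Fin 1 → ℝ) := (-1 : ℝ) • ContinuousLinearMap.id ℝ (Fin 1 → ℝ) with hL
  have hdet : |L.det| = 1 := by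
    have h : L.det = -1 := by
      change LinearMap.det ((L : (Fin 1 → ℝ) →L[ℝ] (Fin 1 → ℝ)) :
        (Fin 1 → ℝ) →ₗ[ℝ] (Fin 1 → ℝ)) = -1
      rw [hL, ContinuousLinearMap.toLinearMap_smul, ContinuousLinearMap.coe_id, LinearMap.det_smul,
        LinearMap.det_id, Module.finrank_fin_fun]
      norm_num
    rw [h]
    norm_num
  refine changeOfVariablesRel_subset_relations
    ⟨1, r, r', fun x => -x, fun _ => L, ?_, fun x _ => ?_, fun x _ y _ h => neg_injective h, hd,
      fun x hx => by rw [hdet, mul_one]; exact hi x hx, rfl⟩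
  · convert isSemialgebraicMapOn_aeval r.isSemialgebraic_domain
      (fun j : Fin 1 => (-X j : MvPolynomial (Fin 1) ℚ)) using 2 with x
    funext j
    simp
  · refine ((hasFDerivAt_id x).neg.congr_fderiv
      (ContinuousLinearMap.ext fun v => ?_)).hasFDerivWithinAt
    simp [hL]

/-! ## The symmetric Beta fold -/

/-- **`[(−1,1), (1 − x²)^γ] ∼ [(0,1), t^{1/2−1} (1 − t)^γ]`** (`γ ∈ ℝ`) for representations pinned
by domain and integrand: remove the null point `x = 0` and split `(−1,1) = (−1,0) ∪ (0,1)`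
(rule 1a), fold `(−1,0)` onto `(0,1)` by `x ↦ −x` (rule 2; the integrand is even), merge the two
copies into `[(0,1), 2(1 − x²)^γ]` (rule 1b), and substitute `t = x²` (rule 2, `x = √t`,
`|dt/dx| = 2x`): `2(1 − x²)^γ = (x²)^{−1/2}(1 − x²)^γ · 2x`. Value identity
`∫_{−1}^{1}(1 − x²)^γ dx = B(1/2, γ + 1)`. [cite: KontsevichZagier2001, §1.2] -/
theorem symmetricBeta_equivalent (γ : ℝ) (p ρ : IntegralRep 1)
    (hpd : p.domain = {x | x 0 ∈ Set.Ioo (-1:ℝ) 1})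
    (hpi : Set.EqOn p.integrand (fun x => (1 - (x 0) ^ 2) ^ γ) p.domain)
    (hρd : ρ.domain = {x | x 0 ∈ Set.Ioo (0:ℝ) 1})
    (hρi : Set.EqOn ρ.integrand (fun x => (x 0) ^ ((1 / 2 : ℝ) - 1) * (1 - x 0) ^ γ) ρ.domain) :
    Equivalent p ρ := by
  have hneg_sub : {x : Fin 1 → ℝ | x 0 ∈ Set.Ioo (-1:ℝ) 0} ⊆ p.domain := by
    rw [hpd]
    exact fun x hx => ⟨hx.1, hx.2.trans zero_lt_one⟩
  have hpos_sub : {x : Fin 1 → ℝ | x 0 ∈ Set.Ioo (0:ℝ) 1} ⊆ p.domain := by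
    rw [hpd]
    exact fun x hx => ⟨(neg_one_lt_zero.trans hx.1), hx.2⟩
  have hUsa := isSemialgebraic_negIoo.union isSemialgebraic_posIoo
  have hU_sub := union_subset hneg_sub hpos_sub
  obtain ⟨pn, hpnd, hpni⟩ : ∃ s : IntegralRep 1, s.domain = {x | x 0 ∈ Set.Ioo (-1:ℝ) 0} ∧
      s.integrand = p.integrand := ⟨p.restrict _ isSemialgebraic_negIoo hneg_sub, rfl, rfl⟩
  obtain ⟨pp, hppd, hppi⟩ : ∃ s : IntegralRep 1, s.domain = {x | x 0 ∈ Set.Ioo (0:ℝ) 1} ∧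
      s.integrand = p.integrand := ⟨p.restrict _ isSemialgebraic_posIoo hpos_sub, rfl, rfl⟩
  -- (1) the null point `x = 0`
  have h1 : of p - of (p.restrict _ hUsa hU_sub) ∈ relations := by
    refine p.of_sub_of_restrict_mem_relations hUsa hU_sub
      (measure_mono_null (fun x hx => ?_) (volume_setOf_apply_eq_const 1 0 0))
    rw [hpd] at hx
    obtain ⟨⟨hl, hr⟩, h3⟩ := hx
    simp only [mem_union, mem_setOf_eq, mem_Ioo, not_or, not_and, not_lt] at h3
    show x 0 = 0
    rcases lt_trichotomy (x 0) 0 with h | h | h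
    · exact absurd (h3.1 hl) (not_le.2 h)
    · exact h
    · exact absurd hr (not_lt.2 (h3.2 h))
  -- (2) domain additivity `(−1,0) ∪ (0,1)`
  have h2 : of (p.restrict _ hUsa hU_sub) - of pn - of pp ∈ relations := by
    refine domainAddRel_subset_relations ⟨1, _, pn, pp, by rw [hpnd, hppd]; rfl, ?_,
      fun x _ => by rw [hpni]; rfl, fun x _ => by rw [hppi]; rfl, rfl⟩
    rw [hpnd, hppd]
    refine measure_mono_null (fun x hx => ?_) measure_empty
    simp only [mem_inter_iff, mem_setOf_eq, mem_Ioo] at hx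
    linarith [hx.1.2, hx.2.1]
  -- (3) fold `(−1,0)` onto `(0,1)` by `x ↦ −x`
  have h3 : of pn - of pp ∈ relations := by
    refine of_sub_of_mem_relations_of_neg ?_ fun x hx => ?_
    · rw [hpnd, hppd]
      ext y
      simp only [mem_setOf_eq, mem_Ioo, mem_image]
      constructor
      · rintro ⟨h0, h1⟩
        exact ⟨-y, ⟨by simp; linarith, by simp; linarith⟩, neg_neg y⟩
      · rintro ⟨x, ⟨h0, h1⟩, rfl⟩
        simp only [Pi.neg_apply]
        exact ⟨by linarith, by linarith⟩
    · rw [hpnd] at hx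
      have hx' : x ∈ p.domain := hneg_sub hx
      have hnx : -x ∈ p.domain := hpos_sub (by
        simp only [mem_setOf_eq, mem_Ioo, Pi.neg_apply]
        exact ⟨by linarith [hx.2], by linarith [hx.1]⟩)
      rw [hpni, hppi, hpi hx', hpi hnx]
      simp
  -- (4) merge the two copies: `D = [(0,1), 2f]`
  obtain ⟨D, hDd, hDi⟩ : ∃ D : IntegralRep 1, D.domain = {x | x 0 ∈ Set.Ioo (0:ℝ) 1} ∧
      D.integrand = fun x => 2 * p.integrand x := by
    refine ⟨⟨_, _, isSemialgebraic_posIoo, ?_, (p.integrableOn.mono_set hpos_sub).const_mul 2⟩,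
      rfl, rfl⟩
    exact (IsSemialgebraicFunOn.mul_holds (isSemialgebraicFunOn_natCast isSemialgebraic_posIoo 2)
      (p.isSemialgebraicFunOn_integrand.mono hpos_sub isSemialgebraic_posIoo)).congr
      fun x _ => by simp
  have h4 : of D - of pp - of pp ∈ relations := by
    refine integrandAddRel_subset_relations ⟨1, D, pp, pp, by rw [hppd, hDd], by rw [hppd, hDd],
      fun x _ => ?_, rfl⟩
    simp only [hDi, hppi, Pi.add_apply]
    ring
  -- (5) `t = x²`
  have h5 : of D - of ρ ∈ relations := by
    refine of_sub_of_mem_relations_of_boxDilation (0 : Fin 1) 1 (fun x hx => ?_) ?_ (fun x hx => ?_)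
    · rw [hDd] at hx
      exact hx.1
    · rw [hρd, hDd]
      ext y
      simp only [mem_setOf_eq, mem_Ioo, mem_image]
      constructor
      · rintro ⟨h0, h1⟩
        refine ⟨fun _ => √(y 0),
          ⟨Real.sqrt_pos.2 h0, (Real.sqrt_lt' one_pos).2 (by simpa using h1)⟩, ?_⟩
        funext i
        rw [Fin.fin_one_eq_zero i, boxDilation_apply_self, Real.sq_sqrt h0.le]
      · rintro ⟨x, ⟨h0, h1⟩, rfl⟩
        rw [boxDilation_apply_self]
        exact ⟨by positivity, pow_lt_one₀ h0.le h1 (by norm_num)⟩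
    · rw [hDd] at hx
      have hx0 : 0 < x 0 := hx.1
      have hx0' : x 0 ≠ 0 := hx0.ne'
      have hxp : x ∈ p.domain := hpos_sub hx
      have hbx : boxDilation 0 1 x ∈ ρ.domain := by
        rw [hρd]
        show boxDilation 0 1 x 0 ∈ Set.Ioo (0:ℝ) 1
        rw [boxDilation_apply_self]
        exact ⟨by positivity, pow_lt_one₀ hx0.le hx.2 (by norm_num)⟩
      rw [hDi]
      dsimp only
      rw [hpi hxp, hρi hbx]
      dsimp only
      rw [boxDilation_apply_self]
      have e1 : (x 0 ^ (1 + 1)) ^ ((1 / 2 : ℝ) - 1) = (x 0)⁻¹ := by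
        rw [← Real.rpow_natCast (x 0) (1 + 1), ← Real.rpow_mul hx0.le, ← Real.rpow_neg_one]
        norm_num
      rw [e1]
      push_cast
      field_simp
  have : of p - of ρ = (of p - of (p.restrict _ hUsa hU_sub)) +
      (of (p.restrict _ hUsa hU_sub) - of pn - of pp) + (of pn - of pp) - (of D - of pp - of pp) +
      (of D - of ρ) := by abel
  rw [Equivalent, this]
  exact relations.add_mem (relations.sub_mem (relations.add_mem (relations.add_mem h1 h2) h3) h4) h5

/-- **`ℚ`-format of the symmetric Beta fold**:
`[(−1,1), (1 − x²)^{b−1}] ∼ [(0,1), t^{a−1}(1−t)^{b−1}]` with `a = 1/2`, `b ∈ ℚ`, the Beta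
side spelled exactly as a Beta representation `β(1/2, b)`. Value identity
`∫_{−1}^{1} (1−x²)^{b−1} dx = B(1/2, b)`. [cite: KontsevichZagier2001, §1.2] -/
theorem symmetricBeta_equivalent_rat (b : ℚ) (p ρ : IntegralRep 1)
    (hpd : p.domain = {x | x 0 ∈ Set.Ioo (-1:ℝ) 1})
    (hpi : Set.EqOn p.integrand (fun x => (1 - (x 0) ^ 2) ^ ((b : ℝ) - 1)) p.domain)
    (hρd : ρ.domain = {x | x 0 ∈ Set.Ioo (0:ℝ) 1})
    (hρi : Set.EqOn ρ.integrand
      (fun x => (x 0) ^ (((1 / 2 : ℚ) : ℝ) - 1) * (1 - x 0) ^ ((b : ℝ) - 1)) ρ.domain) :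
    Equivalent p ρ :=
  symmetricBeta_equivalent ((b : ℝ) - 1) p ρ hpd hpi hρd fun x hx => by
    rw [hρi hx]
    norm_num

/-- **`[(−1,1), (1 − x²)^e] ∼ β(1/2, e + 1)`** (`e ∈ ℕ`, natural power on the left) for pinned
representations. Value identity `∫_{−1}^{1} (1−x²)^e dx = B(1/2, e+1)`.
[cite: KontsevichZagier2001, §1.2] -/
theorem symmetricBeta_equivalent_nat (e : ℕ) (p ρ : IntegralRep 1)
    (hpd : p.domain = {x | x 0 ∈ Set.Ioo (-1:ℝ) 1})
    (hpi : Set.EqOn p.integrand (fun x => (1 - (x 0) ^ 2) ^ e) p.domain)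
    (hρd : ρ.domain = {x | x 0 ∈ Set.Ioo (0:ℝ) 1})
    (hρi : Set.EqOn ρ.integrand
      (fun x => (x 0) ^ (((1 / 2 : ℚ) : ℝ) - 1) * (1 - x 0) ^ ((((e : ℚ) + 1 : ℚ) : ℝ) - 1))
      ρ.domain) :
    Equivalent p ρ :=
  symmetricBeta_equivalent_rat ((e : ℚ) + 1) p ρ hpd (fun x hx => by
    rw [hpi hx]
    dsimp only
    rw [show (((e : ℚ) + 1 : ℚ) : ℝ) - 1 = ((e : ℕ) : ℝ) by push_cast; ring, Real.rpow_natCast])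
    hρd hρi

/-- **`[(−1,1), (1 − x²)^{e + 1/2}] ∼ β(1/2, e + 3/2)`** (`e ∈ ℕ`) for pinned representations.
Value identity `∫_{−1}^{1} (1−x²)^{e+1/2} dx = B(1/2, e+3/2)`. [cite: KontsevichZagier2001, §1.2] -/
theorem symmetricBeta_equivalent_nat_add_half (e : ℕ) (p ρ : IntegralRep 1)
    (hpd : p.domain = {x | x 0 ∈ Set.Ioo (-1:ℝ) 1})
    (hpi : Set.EqOn p.integrand (fun x => (1 - (x 0) ^ 2) ^ ((e : ℝ) + 1 / 2)) p.domain)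
    (hρd : ρ.domain = {x | x 0 ∈ Set.Ioo (0:ℝ) 1})
    (hρi : Set.EqOn ρ.integrand
      (fun x => (x 0) ^ (((1 / 2 : ℚ) : ℝ) - 1) * (1 - x 0) ^ ((((e : ℚ) + 3 / 2 : ℚ) : ℝ) - 1))
      ρ.domain) :
    Equivalent p ρ :=
  symmetricBeta_equivalent_rat ((e : ℚ) + 3 / 2) p ρ hpd (fun x hx => by
    rw [hpi hx]
    dsimp only
    rw [show (((e : ℚ) + 3 / 2 : ℚ) : ℝ) - 1 = (e : ℝ) + 1 / 2 by push_cast; ring])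
    hρd hρi

end BallPeeling

end KZ

end Literature.NumberTheory.Transcendental
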